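import Mathlib
import Summits.NavierStokesRegularity.NavierStokesRegularity.Theorems.DssFarFieldSlavingBlowupTypeIDssProfileSimilarityEnstrophyBeltramiLiouville
import Summits.NavierStokesRegularity.NavierStokesRegularity.Theorems.DssFarFieldSlavingBlowupTypeIDssProfileSimilarityEnstrophyCrossFlowThreshold
import Summits.NavierStokesRegularity.NavierStokesRegularity.Theorems.SymmetryModuliCountStretchingCertificateComparisonMaxPrinciple
import Summits.NavierStokesRegularity.NavierStokesRegularity.Theorems.IsobarTomographyBlobRiccatiClosureTypeIGaugeBounds
import Literature.Analysis.FluidPDE.TypeIAncientMildClassical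
import Literature.Analysis.FluidPDE.AncientSimilarityVorticity
import Literature.Analysis.FluidPDE.CurlFreeLiouville
import HarnessLib

/-!
# T33, the hypothesis-free half: `sup |Ω| ≤ sup |curl (Ω × U)|` for every KNSS-gauge Type-I ancient
  mild field, by the weak maximum principle; the LAMB-CURL DEFECT FLOOR `θ < 1` and its CLASS level
  (pub-ns-dss theory EXPLICIT-THRESHOLDS row T33, second inequality — DERIVED on paper by the vorticity
  Duhamel formula with `‖G_σ‖₁ = 1`; here a tree theorem by comparison; route `DssFarFieldSlaving`, crux
  `BlowupTypeIDssProfile`, stmt-NavierStokesRegularity-0155 — SUPPORT; typer seat g20, 2026-08-26)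

HONEST FRAMING. Statements about a HYPOTHETICAL object (a Type-I ancient mild solution in the
Koch–Nadirashvili–Seregin–Šverák gauge, `IsTypeIAncientMild C V`, ANY constant `C`; NO spatial decay, NO
envelope `HasTypeIDecay` at the classical level). The bound is an a-priori inequality every such field
satisfies; the Liouville corollary is conditional on a pointwise hypothesis nobody asserts; `1` is the
threshold of the argument and nothing is said at or above it; nothing numerical; census words on ACCEPT,
if any, are the lead's; nothing here bears on Navier–Stokes regularity or blow-up.

THE BOUND (`mul_norm_curl_le_of_curl_lamb_bound`). With `ω = curl V(t)`: if
`(−τ)²‖curl (ω × V)(τ, y)‖ ≤ S` for all `τ < 0`, `y`, then `(−t)‖ω(t, x)‖ ≤ S` for all `t < 0`, `x`. In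
similarity variables (`Ω(s,y) = (−t)ω(t,x)`, `U = √(−t)V`, `curl_y(Ω × U) = (−t)² curl_x(ω × V)`) this is
row T33's `sup_{s,y} |Ω| ≤ sup_{s,y} |curl_y (Ω × U)|`, constant `1`. PROOF by comparison, not Duhamel:
the vorticity equation in Lamb form is `∂ₜω − Δω = −curl (ω × V)` (classical on every window `(t₁, 0)`:
`IsTypeIAncientMild.exists_isClassicalNSSolutionOn_Ioo`, `IsClassicalNSSolutionOn.isVorticitySolutionOn_zero_force`,
`curl_cross_apply`); for a fixed vector `e` and `T₁ < t₀ < 0` the scalar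
`P(t,x) = ⟪e, ω(t,x)⟫ − K₀‖e‖/(−T₁) − S‖e‖(1/(−t) − 1/(−T₁))` is a bounded subsolution of the heat
equation on `[T₁, t₀] × ℝ³` with `P(T₁, ·) ≤ 0` (`K₀` the class-uniform gauge constant of
`typeIGauge_exists_pow_mul_norm_iteratedFDeriv_le`, `(−t)‖ω‖ ≤ K₀`), so `P ≤ 0` by the tree's whole-space
weak maximum principle `le_of_subsolution_linear_drift` (zero drift); letting `T₁ → −∞` kills the gauge
term, and `e = ω(t₀, x₀)` gives the bound.

THE FLOOR (`typeI_ancient_eq_zero_of_curl_lamb_le`). If `(−t)‖curl (ω × V)(t,x)‖ ≤ θ‖ω(t,x)‖` for all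
`t < 0`, `x` (similarity form `|curl (Ω × U)| ≤ θ|Ω|` pointwise) with `θ < 1`, then `V ≡ 0`: iterate the
bound (`(−t)‖ω‖ ≤ θⁿ K₀` for every `n`), so `ω ≡ 0`, and a curl-free divergence-free bounded field is
constant, which the Oseen gauge kills. NO envelope, NO (D), ANY `C`. The endpoint `θ = 0` is the
generalised-Beltrami Liouville theorem T33 of `…SimilarityEnstrophyBeltramiLiouville` (re-derived as a
kernel-checked `example`). Portrait reading (an index, never a gate): every non-trivial field of the class
has LAMB-CURL DEFECT `sup_{Ω ≠ 0} |curl (Ω × U)|/|Ω| ≥ 1`. CLASS level: `rdssClass_empty_of_curlLambDefect`.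
-/

noncomputable section

set_option linter.dupNamespace false

namespace Summit.NavierStokesRegularity.NavierStokesRegularity.Theorems.LambCurlBound

open MeasureTheory Set Filter Topology Module Metric InnerProductSpace Function
open scoped RealInnerProductSpace Laplacian ContDiff
open Literature.Analysis Literature.Analysis.FluidPDE
open Summit.NavierStokesRegularity.NavierStokesRegularity.Theorems
open Summit.NavierStokesRegularity.NavierStokesRegularity.Theorems.BlobRiccatiClosure.TypeIApexLiouville

variable {C : ℝ} {V : ℝ → EuclideanSpace ℝ (Fin 3) → EuclideanSpace ℝ (Fin 3)}

/-! ### The class-uniform vorticity gauge bound -/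

/-- **`(−t)‖ω(t,x)‖ ≤ K₀` uniformly over the class** (`K₀ = ‖curl‖_op · K(C,1)` from the scale-invariant
gauge bound `typeIGauge_exists_pow_mul_norm_iteratedFDeriv_le`, KNSS 2009 Prop. 4.1). [folklore] -/
theorem exists_mul_norm_curl_le (C : ℝ) :
    ∃ K₀ : ℝ, 0 ≤ K₀ ∧ ∀ ⦃V : ℝ → EuclideanSpace ℝ (Fin 3) → EuclideanSpace ℝ (Fin 3)⦄,
      IsTypeIAncientMild C V → ∀ t < 0, ∀ x, (-t) * ‖curl (V t) x‖ ≤ K₀ := by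
  obtain ⟨K₁, hK₁⟩ := typeIGauge_exists_pow_mul_norm_iteratedFDeriv_le C 1
  set κ₀ : ℝ := ‖(curlCLM : (EuclideanSpace ℝ (Fin 3) →L[ℝ] EuclideanSpace ℝ (Fin 3)) →L[ℝ]
    EuclideanSpace ℝ (Fin 3))‖ with hκ₀
  have hκ₀0 : 0 ≤ κ₀ := by rw [hκ₀]; positivity
  have hcurl_le : ∀ (f : EuclideanSpace ℝ (Fin 3) → EuclideanSpace ℝ (Fin 3)) (x),
      ‖curl f x‖ ≤ κ₀ * ‖iteratedFDeriv ℝ 1 f x‖ := fun f x => by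
    rw [curl_eq_curlCLM, ← norm_iteratedFDeriv_fderiv, norm_iteratedFDeriv_zero]
    exact ContinuousLinearMap.le_opNorm _ _
  refine ⟨κ₀ * max K₁ 0, by positivity, fun V hV t ht x => ?_⟩
  have h := hK₁ hV t ht x
  have e2 : Real.sqrt (-t) ^ (1 + 1) = -t := by
    rw [show (1 + 1 : ℕ) = 2 from rfl, Real.sq_sqrt (neg_pos.2 ht).le]
  rw [e2] at h
  calc (-t) * ‖curl (V t) x‖ ≤ (-t) * (κ₀ * ‖iteratedFDeriv ℝ 1 (V t) x‖) :=
        mul_le_mul_of_nonneg_left (hcurl_le _ x) (neg_pos.2 ht).le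
    _ = κ₀ * ((-t) * ‖iteratedFDeriv ℝ 1 (V t) x‖) := by ring
    _ ≤ κ₀ * max K₁ 0 := mul_le_mul_of_nonneg_left (h.trans (le_max_left _ _)) hκ₀0

/-! ### The vorticity equation in Lamb form on a window -/

/-- **The vorticity equation in Lamb form**, `∂ₜω = Δω − curl (ω × V)`, at every point of a window
`(a, 0)` on which the field is a classical solution (`curl (ω × V) = (V·∇)ω − (ω·∇)V` for divergence-free
`ω, V`, `curl_cross_apply`). [cite: MajdaBertozziCUP2002, §1.1 (vector identities)] -/
theorem deriv_curl_eq_laplacian_sub_curl_lamb (hV : IsTypeIAncientMild C V) {a : ℝ}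
    {p : ℝ → EuclideanSpace ℝ (Fin 3) → ℝ} (hsol : IsClassicalNSSolutionOn (Ioo a 0) 1 0 V p)
    {t : ℝ} (ht : t ∈ Ioo a 0) (x : EuclideanSpace ℝ (Fin 3)) :
    deriv (fun s => curl (V s) x) t =
      (Δ (curl (V t))) x - curl (fun y => cross (curl (V t) y) (V t y)) x := by
  have hVS := hsol.isVorticitySolutionOn_zero_force isOpen_Ioo.uniqueDiffOn
    (by rw [interior_Ioo]; exact subset_closure)
  have h := hVS.vorticity_eq t ht x
  simp only [timeDerivWithin_eq_deriv isOpen_Ioo ht, convect_apply, vorticity_apply, one_smul] at h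
  have ht0 : t < 0 := ht.2
  have hV3 : ContDiff ℝ 3 (V t) := (hV.contDiff_slice ht0).of_le (by norm_cast)
  have hω : ContDiff ℝ 2 (curl (V t)) := contDiff_curl hV3
  have hdω : DifferentiableAt ℝ (curl (V t)) x := (hω.differentiable (by norm_num)) x
  have hdV : DifferentiableAt ℝ (V t) x := (hV3.differentiable (by norm_num)) x
  rw [curl_cross_apply hdω hdV, hV.isDivFree ht0 x,
    divergence_curl_eq_zero_holds _ (hV3.of_le (by norm_cast)) x, zero_smul, zero_smul,
    sub_zero, add_zero]
  rw [← sub_eq_iff_eq_add.2 h.symm] -- deriv = DV(ω) + Δω − Dω(V)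
  abel

/-! ### The bound `sup |Ω| ≤ sup |curl (Ω × U)|` -/

/-- **One-slab comparison step.** For `T₁ < t₀ < 0`, a vector `e`, a gauge constant `K₀` with
`(−t)‖ω‖ ≤ K₀` on the class and the Lamb-curl bound `(−τ)²‖curl(ω × V)‖ ≤ S`:
`⟪e, ω(t₀,x₀)⟫ ≤ K₀‖e‖/(−T₁) + S‖e‖(1/T₁ − 1/t₀)` — the weak maximum principle
`le_of_subsolution_linear_drift` (zero drift) for
`P = ⟪e, ω⟫ − K₀‖e‖/(−T₁) − S‖e‖(1/T₁ − 1/t)` on `[T₁, t₀] × ℝ³`. [this file] -/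
theorem inner_curl_le_slab (hV : IsTypeIAncientMild C V) {K₀ S : ℝ} (hK₀ : 0 ≤ K₀)
    (hω : ∀ t < 0, ∀ x, (-t) * ‖curl (V t) x‖ ≤ K₀) (hS0 : 0 ≤ S)
    (hS : ∀ τ < 0, ∀ y, (-τ) ^ 2 * ‖curl (fun z => cross (curl (V τ) z) (V τ z)) y‖ ≤ S)
    {T₁ t₀ : ℝ} (hT : T₁ < t₀) (ht₀ : t₀ < 0) (e x₀ : EuclideanSpace ℝ (Fin 3)) :
    ⟪e, curl (V t₀) x₀⟫ ≤ K₀ * ‖e‖ / (-T₁) + S * ‖e‖ * (T₁⁻¹ - t₀⁻¹) := by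
  have hT₁0 : T₁ < 0 := hT.trans ht₀
  have hnegT₁ : 0 < -T₁ := neg_pos.2 hT₁0
  -- classical on the window `(T₁ − 1, 0)`
  obtain ⟨p, hsol⟩ := hV.exists_isClassicalNSSolutionOn_Ioo (t₀ := T₁ - 1) (by linarith)
  have hsm : IsSmoothSpaceTimeOn (Ioo (T₁ - 1) 0) V := hsol.smooth_velocity
  have hvort : IsSmoothSpaceTimeOn (Ioo (T₁ - 1) 0) (vorticity V) := by
    have h1 := (hsm.isSmoothSpaceTimeOn_fderiv_of_isOpen isOpen_Ioo).clm curlCLM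
    have eq : (fun t x => curlCLM (fderiv ℝ (V t) x)) = vorticity V := by funext s y; rfl
    rwa [eq] at h1
  have hIoc_sub : ∀ {s}, s ∈ Ioc T₁ t₀ → s ∈ Ioo (T₁ - 1) 0 := fun {s} hs =>
    ⟨by linarith [hs.1], hs.2.trans_lt ht₀⟩
  have hIcc_sub : ∀ {s}, s ∈ Icc T₁ t₀ → s ∈ Ioo (T₁ - 1) 0 := fun {s} hs =>
    ⟨by linarith [hs.1], hs.2.trans_lt ht₀⟩
  -- the comparison function and its time derivative
  set A : ℝ := K₀ * ‖e‖ / (-T₁) with hAdef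
  have hA0 : 0 ≤ A := by positivity
  set g : ℝ → ℝ := fun s => A + S * ‖e‖ * (T₁⁻¹ - s⁻¹) with hgdef
  set P : ℝ → EuclideanSpace ℝ (Fin 3) → ℝ := fun s y => ⟪e, curl (V s) y⟫ - g s with hPdef
  set Pₜ : ℝ → EuclideanSpace ℝ (Fin 3) → ℝ := fun s y =>
    ⟪e, deriv (fun σ => curl (V σ) y) s⟫ - S * ‖e‖ * (s ^ 2)⁻¹ with hPₜdef
  have key := le_of_subsolution_linear_drift (T₁ := T₁) (T₂ := t₀) (M := 0)
    (B := K₀ * ‖e‖ / (-t₀)) (K := 0) (P := P) (Pₜ := Pₜ) le_rfl ?_ ?_ ?_ ?_ ?_ ?_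
  · have h := key t₀ ⟨hT.le, le_rfl⟩ x₀
    simp only [hPdef, hgdef, hAdef, sub_nonpos] at h
    linarith
  · -- joint continuity on `[T₁, t₀] × ℝ³`
    have hωc : ContinuousOn (fun z : ℝ × EuclideanSpace ℝ (Fin 3) => ⟪e, vorticity V z.1 z.2⟫)
        (Icc T₁ t₀ ×ˢ univ) := by
      refine (continuousOn_const.inner (hvort.continuousOn.mono ?_))
      exact prod_mono (fun s hs => hIcc_sub hs) subset_rfl
    have hgc : ContinuousOn (fun z : ℝ × EuclideanSpace ℝ (Fin 3) => g z.1) (Icc T₁ t₀ ×ˢ univ) := by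
      refine continuousOn_const.add (continuousOn_const.mul (continuousOn_const.sub ?_))
      refine (continuousOn_fst.inv₀ fun z hz => ?_)
      have hz1 : z.1 ∈ Icc T₁ t₀ := (mem_prod.1 hz).1
      exact (lt_of_le_of_lt hz1.2 ht₀).ne
    refine (hωc.sub hgc).congr fun z _ => ?_
    simp only [hPdef, uncurry, vorticity_apply, Pi.sub_apply]
  · -- `C²` slices
    intro s hs
    have hω2 : ContDiff ℝ 2 (curl (V s)) := by
      rw [← vorticity_apply]
      exact (hvort.contDiff_slice (hIoc_sub hs)).of_le (by norm_cast)
    exact (contDiff_const.inner ℝ hω2).sub contDiff_const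
  · -- time derivative
    intro s hs y
    have hs' := hIoc_sub hs
    have hs0 : s ≠ 0 := (hs.2.trans_lt ht₀).ne
    have hωt : HasDerivAt (fun σ => curl (V σ) y) (deriv (fun σ => curl (V σ) y) s) s := by
      have h := hvort.hasDerivAt_timeLine isOpen_Ioo hs' y
      simpa only [vorticity_apply] using h
    have hin : HasDerivAt (fun σ => ⟪e, curl (V σ) y⟫) ⟪e, deriv (fun σ => curl (V σ) y) s⟫ s := by
      have h := (hasDerivAt_const s e).inner ℝ hωt
      simpa using h
    have hg : HasDerivAt g (S * ‖e‖ * (s ^ 2)⁻¹) s := by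
      have h1 : HasDerivAt (fun σ : ℝ => T₁⁻¹ - σ⁻¹) (0 - (-(s ^ 2)⁻¹)) s :=
        (hasDerivAt_const s T₁⁻¹).sub (hasDerivAt_inv hs0)
      have h2 := (h1.const_mul (S * ‖e‖)).const_add A
      exact h2.congr_deriv (by ring)
    exact hin.sub hg
  · -- the subsolution inequality `Pₜ ≤ ΔP`
    intro s hs y
    have hs' := hIoc_sub hs
    have hs0' : s < 0 := hs.2.trans_lt ht₀
    have hω2 : ContDiff ℝ 2 (curl (V s)) := by
      rw [← vorticity_apply]
      exact (hvort.contDiff_slice hs').of_le (by norm_cast)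
    -- Laplacian of the slice
    have hLap : (Δ (P s)) y = ⟪e, (Δ (curl (V s))) y⟫ := by
      have hPs : P s = (fun z => ⟪e, curl (V s) z⟫) - fun _ => g s := by
        funext z; simp only [hPdef, Pi.sub_apply]
      have hin2 : ContDiff ℝ 2 fun z => ⟪e, curl (V s) z⟫ := contDiff_const.inner ℝ hω2
      rw [hPs, hin2.contDiffAt.laplacian_sub contDiffAt_const, laplacian_const, Pi.zero_apply,
        sub_zero]
      have hcomp : (fun z => ⟪e, curl (V s) z⟫) =
          (innerSL ℝ e : EuclideanSpace ℝ (Fin 3) →L[ℝ] ℝ) ∘ curl (V s) := by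
        funext z; simp
      rw [hcomp, hω2.contDiffAt.laplacian_CLM_comp_left]
      simp
    -- the vorticity equation and the Lamb-curl bound
    have hveq := deriv_curl_eq_laplacian_sub_curl_lamb hV hsol hs' y
    have hcl : -⟪e, curl (fun z => cross (curl (V s) z) (V s z)) y⟫ ≤ S * ‖e‖ * (s ^ 2)⁻¹ := by
      have h1 : -⟪e, curl (fun z => cross (curl (V s) z) (V s z)) y⟫ ≤
          ‖e‖ * ‖curl (fun z => cross (curl (V s) z) (V s z)) y‖ :=
        (neg_le_abs _).trans (abs_real_inner_le_norm _ _)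
      have h2 : ‖curl (fun z => cross (curl (V s) z) (V s z)) y‖ ≤ S * (s ^ 2)⁻¹ := by
        have h := hS s hs0' y
        rw [neg_sq] at h
        rwa [← div_eq_mul_inv, le_div_iff₀ (sq_pos_of_neg hs0'), mul_comm]
      calc -⟪e, curl (fun z => cross (curl (V s) z) (V s z)) y⟫
          ≤ ‖e‖ * ‖curl (fun z => cross (curl (V s) z) (V s z)) y‖ := h1
        _ ≤ ‖e‖ * (S * (s ^ 2)⁻¹) := mul_le_mul_of_nonneg_left h2 (norm_nonneg _)
        _ = S * ‖e‖ * (s ^ 2)⁻¹ := by ring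
    show Pₜ s y ≤ (Δ (P s)) y + 0 * (1 + ‖y‖) * ‖fderiv ℝ (P s) y‖
    rw [hLap, zero_mul, zero_mul, add_zero]
    have e1 : Pₜ s y = ⟪e, deriv (fun σ => curl (V σ) y) s⟫ - S * ‖e‖ * (s ^ 2)⁻¹ := rfl
    rw [e1, hveq, inner_sub_right]
    linarith
  · -- bounded above on `[T₁, t₀] × ℝ³`
    intro s hs y
    have hs0' : s < 0 := lt_of_le_of_lt hs.2 ht₀
    have hnegs : 0 < -s := neg_pos.2 hs0'
    have h1 : ⟪e, curl (V s) y⟫ ≤ ‖e‖ * ‖curl (V s) y‖ := real_inner_le_norm _ _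
    have h2 : ‖curl (V s) y‖ ≤ K₀ / (-s) := by
      rw [le_div_iff₀ hnegs, mul_comm]; exact hω s hs0' y
    have h3 : K₀ / (-s) ≤ K₀ / (-t₀) :=
      div_le_div_of_nonneg_left hK₀ (neg_pos.2 ht₀) (by linarith [hs.2])
    have hg0 : 0 ≤ g s := by
      have hinv : s⁻¹ ≤ T₁⁻¹ := (inv_le_inv_of_neg hs0' hT₁0).2 hs.1
      have : 0 ≤ S * ‖e‖ * (T₁⁻¹ - s⁻¹) := by
        have := sub_nonneg.2 hinv; positivity
      simp only [hgdef]; linarith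
    show ⟪e, curl (V s) y⟫ - g s ≤ K₀ * ‖e‖ / (-t₀)
    have h4 : ‖e‖ * ‖curl (V s) y‖ ≤ ‖e‖ * (K₀ / (-t₀)) :=
      mul_le_mul_of_nonneg_left (h2.trans h3) (norm_nonneg _)
    have e5 : ‖e‖ * (K₀ / (-t₀)) = K₀ * ‖e‖ / (-t₀) := by ring
    linarith
  · -- the initial slice `P(T₁, ·) ≤ 0`
    intro y
    have h1 : ⟪e, curl (V T₁) y⟫ ≤ ‖e‖ * ‖curl (V T₁) y‖ := real_inner_le_norm _ _
    have h2 : ‖curl (V T₁) y‖ ≤ K₀ / (-T₁) := by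
      rw [le_div_iff₀ hnegT₁, mul_comm]; exact hω T₁ hT₁0 y
    have hgT : g T₁ = A := by simp only [hgdef, sub_self, mul_zero, add_zero]
    show ⟪e, curl (V T₁) y⟫ - g T₁ ≤ 0
    rw [hgT, hAdef]
    have h4 : ‖e‖ * ‖curl (V T₁) y‖ ≤ ‖e‖ * (K₀ / (-T₁)) :=
      mul_le_mul_of_nonneg_left h2 (norm_nonneg _)
    have e5 : ‖e‖ * (K₀ / (-T₁)) = K₀ * ‖e‖ / (-T₁) := by ring
    linarith

/-- **T33, hypothesis-free half: `sup |Ω| ≤ sup |curl (Ω × U)|`** (theory EXPLICIT-THRESHOLDS row T33,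
second inequality; physical-variables form). For every Type-I ancient mild field in the KNSS gauge
(`IsTypeIAncientMild C V`, ANY `C`, NO spatial hypothesis): if `(−τ)²‖curl (ω × V)(τ,y)‖ ≤ S` for all
`τ < 0`, `y` (`ω = curl V(τ)`), then `(−t)‖ω(t,x)‖ ≤ S` for all `t < 0`, `x`. Proof: the slab comparison
`inner_curl_le_slab` for every `T₁ < t`, `T₁ → −∞` kills the gauge term `K₀‖e‖/(−T₁)`, and `e = ω(t,x)`.
[this file; theory row T33 (DERIVED on paper by the vorticity Duhamel formula); nothing here bears on
NS regularity] -/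
theorem mul_norm_curl_le_of_curl_lamb_bound (hV : IsTypeIAncientMild C V) {S : ℝ}
    (hS : ∀ τ < 0, ∀ y, (-τ) ^ 2 * ‖curl (fun z => cross (curl (V τ) z) (V τ z)) y‖ ≤ S) :
    ∀ t < 0, ∀ x, (-t) * ‖curl (V t) x‖ ≤ S := by
  have hS0 : 0 ≤ S := le_trans (mul_nonneg (sq_nonneg _) (norm_nonneg _)) (hS (-1) (by norm_num) 0)
  obtain ⟨K₀, hK₀, hKω⟩ := exists_mul_norm_curl_le C
  have hω := hKω hV
  -- `⟪e, ω(t,x)⟫ ≤ S‖e‖/(−t)` for every `e`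
  have key : ∀ t < 0, ∀ (x e : EuclideanSpace ℝ (Fin 3)), ⟪e, curl (V t) x⟫ ≤ S * ‖e‖ / (-t) := by
    intro t ht x e
    have hnegt : 0 < -t := neg_pos.2 ht
    refine le_of_forall_pos_le_add fun ε hε => ?_
    -- `T₁ < t` with `K₀‖e‖/(−T₁) ≤ ε`
    set T₁ : ℝ := t - 1 - K₀ * ‖e‖ / ε with hT₁
    have hKe : 0 ≤ K₀ * ‖e‖ / ε := by positivity
    have hT₁t : T₁ < t := by rw [hT₁]; linarith
    have hnegT₁ : 0 < -T₁ := by linarith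
    have hA : K₀ * ‖e‖ / (-T₁) ≤ ε := by
      rw [div_le_iff₀ hnegT₁]
      have e1 : ε * (-T₁) = ε * (-t) + ε + K₀ * ‖e‖ := by
        rw [hT₁]; field_simp; ring
      nlinarith [mul_pos hε hnegt]
    have h := inner_curl_le_slab hV hK₀ hω hS0 hS hT₁t ht e x
    -- `S‖e‖(1/T₁ − 1/t) = S‖e‖/(−t) − S‖e‖/(−T₁) ≤ S‖e‖/(−t)`
    have hdrop : S * ‖e‖ * (T₁⁻¹ - t⁻¹) ≤ S * ‖e‖ / (-t) := by
      have hT₁inv : T₁⁻¹ ≤ 0 := inv_nonpos.2 (by linarith)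
      have e2 : S * ‖e‖ / (-t) = S * ‖e‖ * (-t⁻¹) := by rw [div_eq_mul_inv, inv_neg]
      rw [e2]
      exact mul_le_mul_of_nonneg_left (by linarith) (by positivity)
    linarith
  intro t ht x
  have hnegt : 0 < -t := neg_pos.2 ht
  have h := key t ht x (curl (V t) x)
  rw [real_inner_self_eq_norm_sq] at h
  rcases eq_or_lt_of_le (norm_nonneg (curl (V t) x)) with h0 | hpos
  · rw [← h0, mul_zero]; exact hS0
  · -- divide `‖ω‖² ≤ S‖ω‖/(−t)` by `‖ω‖ > 0`
    rw [le_div_iff₀ hnegt] at h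
    nlinarith

/-! ### The LAMB-CURL DEFECT FLOOR and its class level -/

/-- **The LAMB-CURL DEFECT FLOOR, CLASSICAL, UNCONDITIONAL (no envelope, no (D), any `C`).** A Type-I
ancient mild field in the KNSS gauge with `(−t)‖curl (ω × V)(t,x)‖ ≤ θ‖ω(t,x)‖` for all `t < 0`, `x`
(similarity form `|curl (Ω × U)| ≤ θ|Ω|` pointwise) and `θ < 1` vanishes identically on `t < 0`:
`(−t)‖ω‖ ≤ θ₊ⁿ K₀` for every `n` by iterating `mul_norm_curl_le_of_curl_lamb_bound` (`θ₊ = max θ 0 < 1`),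
hence `ω ≡ 0`; a curl-free divergence-free bounded field is constant
(`eq_of_curl_eq_zero_of_isDivFree_of_bounded`) and the Oseen gauge kills constants
(`IsTypeIAncientMild.eq_zero_of_slice_const`). The endpoint `θ = 0` is T33
(`SimilarityEnstrophy.typeI_ancient_eq_zero_of_generalisedBeltrami`). [this file; conditional statement —
nothing asserts the hypothesis for a given field; nothing here bears on NS regularity] -/
theorem typeI_ancient_eq_zero_of_curl_lamb_le (hV : IsTypeIAncientMild C V) {θ : ℝ} (hθ : θ < 1)
    (h : ∀ t < 0, ∀ x,
      (-t) * ‖curl (fun z => cross (curl (V t) z) (V t z)) x‖ ≤ θ * ‖curl (V t) x‖) :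
    ∀ t < 0, ∀ x, V t x = 0 := by
  obtain ⟨K₀, hK₀, hKω⟩ := exists_mul_norm_curl_le C
  have hω := hKω hV
  set θ' : ℝ := max θ 0 with hθ'
  have hθ'0 : 0 ≤ θ' := le_max_right _ _
  have hθ'1 : θ' < 1 := max_lt hθ one_pos
  -- iteration: `(−t)‖ω‖ ≤ θ'ⁿ K₀`
  have hiter : ∀ n : ℕ, ∀ t < 0, ∀ x, (-t) * ‖curl (V t) x‖ ≤ θ' ^ n * K₀ := by
    intro n
    induction n with
    | zero => intro t ht x; simpa using hω t ht x
    | succ n ih =>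
      refine mul_norm_curl_le_of_curl_lamb_bound hV fun τ hτ y => ?_
      have hnegτ : 0 < -τ := neg_pos.2 hτ
      calc (-τ) ^ 2 * ‖curl (fun z => cross (curl (V τ) z) (V τ z)) y‖
          = (-τ) * ((-τ) * ‖curl (fun z => cross (curl (V τ) z) (V τ z)) y‖) := by ring
        _ ≤ (-τ) * (θ * ‖curl (V τ) y‖) := mul_le_mul_of_nonneg_left (h τ hτ y) hnegτ.le
        _ ≤ (-τ) * (θ' * ‖curl (V τ) y‖) :=
            mul_le_mul_of_nonneg_left (mul_le_mul_of_nonneg_right (le_max_left _ _) (norm_nonneg _))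
              hnegτ.le
        _ = θ' * ((-τ) * ‖curl (V τ) y‖) := by ring
        _ ≤ θ' * (θ' ^ n * K₀) := mul_le_mul_of_nonneg_left (ih τ hτ y) hθ'0
        _ = θ' ^ (n + 1) * K₀ := by ring
  -- hence `ω ≡ 0`
  have hcurl : ∀ t < 0, ∀ x, curl (V t) x = 0 := by
    intro t ht x
    have hnegt : 0 < -t := neg_pos.2 ht
    have hlim : Tendsto (fun n : ℕ => θ' ^ n * K₀) atTop (𝓝 (0 * K₀)) :=
      (tendsto_pow_atTop_nhds_zero_of_lt_one hθ'0 hθ'1).mul_const K₀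
    rw [zero_mul] at hlim
    have hle : (-t) * ‖curl (V t) x‖ ≤ 0 :=
      ge_of_tendsto' hlim fun n => hiter n t ht x
    have hn : ‖curl (V t) x‖ ≤ 0 := by
      nlinarith [hle, hnegt, norm_nonneg (curl (V t) x)]
    exact norm_le_zero_iff.1 hn
  have hconst : ∀ t < 0, ∀ x, V t x = V t 0 := fun t ht x =>
    eq_of_curl_eq_zero_of_isDivFree_of_bounded ((hV.contDiff_slice ht).of_le (by norm_cast))
      (hcurl t ht) (hV.isDivFree ht) (fun z => hV.norm_le ht z) x 0
  exact fun t ht x => hV.eq_zero_of_slice_const (b := fun t => V t 0) hconst ht x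

/-- **T33 re-derived as the endpoint `θ = 0`** (the exact statement of the tree's
`SimilarityEnstrophy.typeI_ancient_eq_zero_of_generalisedBeltrami`, which stays the declaration of record —
hence a kernel-checked `example`, not a theorem). [this file; bookkeeping] -/
example (hV : IsTypeIAncientMild C V)
    (hbel : ∀ t < 0, ∀ x, curl (fun y => cross (curl (V t) y) (V t y)) x = 0) :
    ∀ t < 0, ∀ x, V t x = 0 :=
  typeI_ancient_eq_zero_of_curl_lamb_le hV one_half_lt_one fun t ht x => by
    rw [hbel t ht x, norm_zero, mul_zero]; positivity

/-- **The LAMB-CURL DEFECT FLOOR at CLASS level, UNCONDITIONAL** (∀-representative shape of the T33 class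
statement `SimilarityEnstrophy.rdssClass_generalisedBeltrami_empty_unconditional`, with the Beltrami identity
`curl (ω × V) = 0` relaxed to the defect bound `(−t)‖curl (ω × V)‖ ≤ θ‖ω‖`; class C_H3 verbatim). For every
Type-I level `M` and every `θ < 1`: NO non-trivial member of the hypothesis class of `RdssProfileTruncation`
(`1 < c`, `IsAncientMildSolution 1 u`, measurable slices, `IsRotatedDSS c R u` with ANY twist `R ∈ O(3)`,
`HasTypeIDecay M u`) has all its smooth KNSS representatives (`IsTypeIAncientMild M V`, `V(t) = u(t)` a.e.)
satisfying `(−t)·‖curl (ω × V)(t,x)‖ ≤ θ·‖ω(t,x)‖` for all `t < 0` and all `x` (`ω = curl V(t)`).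
Portrait reading (an index, never a gate): every survivor has Lamb-curl defect
`sup_{Ω ≠ 0} |curl_y (Ω × U)|/|Ω| ≥ 1` at every `M`. Proof: a smooth representative exists
(`typeI_ancient_smoothRepresentative_ae`) and vanishes (`typeI_ancient_eq_zero_of_curl_lamb_le`). DSS-blind.
[this file; census words on ACCEPT, if any, are the lead's; nothing numerical is asserted; no sharpness
claimed; nothing here bears on NS regularity] -/
theorem rdssClass_empty_of_curlLambDefect (M : ℝ) {θ : ℝ} (hθ : θ < 1) :
    ¬ ∃ (c : ℝ) (R : (EuclideanSpace ℝ (Fin 3)) ≃ₗᵢ[ℝ] (EuclideanSpace ℝ (Fin 3)))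
        (u : ℝ → (EuclideanSpace ℝ (Fin 3)) → (EuclideanSpace ℝ (Fin 3))),
      1 < c ∧ IsAncientMildSolution 1 u ∧ (∀ t < 0, AEStronglyMeasurable (u t) volume) ∧
      IsRotatedDSS c R u ∧ HasTypeIDecay M u ∧
      (∀ V : ℝ → EuclideanSpace ℝ (Fin 3) → EuclideanSpace ℝ (Fin 3), IsTypeIAncientMild M V →
        (∀ t < 0, V t =ᵐ[volume] u t) →
        ∀ t < 0, ∀ x,
          (-t) * ‖curl (fun z => cross (curl (V t) z) (V t z)) x‖ ≤ θ * ‖curl (V t) x‖) ∧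
      ¬ (∀ t < 0, u t =ᵐ[volume] 0) := by
  rintro ⟨c, R, u, -, hmild, hmeas, -, hdec, hrep, hne⟩
  obtain ⟨V, hT, -, hVu, -⟩ := typeI_ancient_smoothRepresentative_ae hmild hmeas hdec
  have hz : ∀ t < 0, ∀ x, V t x = 0 :=
    typeI_ancient_eq_zero_of_curl_lamb_le hT hθ (hrep V hT hVu)
  refine hne fun t ht => ?_
  have hVz : V t = 0 := funext fun x => by simpa using hz t ht x
  exact (hVu t ht).symm.trans (Filter.EventuallyEq.of_eq hVz)

end Summit.NavierStokesRegularity.NavierStokesRegularity.Theorems.LambCurlBound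

end
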